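import Literature.NumberTheory.Transcendental.MultipleZeta
import HarnessLib

/-!
# The star expansion `k ↦ k⋆` of an index and multiple zeta-star values

Definition file (Literature, `NumberTheory/Transcendental`), written for route
KontsevichZagierPeriods/FurushoPentagon (support item `DoubleShuffleInKZ`, stmt-14665), where the
Kaneko–Yamamoto "integral = series" identity `ζ(μ(k, l)) = ζ(k ⊛ l⋆)` [KanekoYamamoto2018, Thm 4.1]
is used with `l = (1, …, 1)`, whose star expansion `(1ⁿ)⋆` is the formal sum of all COMPOSITIONS of `n`.

* `MZV.starIndices k` — Hoffman's / Kaneko–Yamamoto's **star expansion** `k⋆` of an index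
  `k = (k₁, …, k_r)`: the list of the `2^{r-1}` indices `(k₁ ○ k₂ ○ ⋯ ○ k_r)` obtained by replacing
  each `○` by a comma or by a plus sign [KanekoYamamoto2018, §2 ("we write `k⋆` for the formal sum
  of `2^{r-1}` indices")]; recursion on the first comma: `(a, b, k)⋆ = a·(b, k)⋆ + (a + b, k)⋆`.
  It does not depend on the reading direction of indices, so it serves the tree's convention
  (`MZV.IsAdmissible`: FIRST entry `≥ 2`, series `Σ_{n₁ > n₂ > ⋯}`) verbatim.
* `MZV.multipleZetaStar k = Σ_{u ∈ k⋆} ζ(u)` — the **multiple zeta-star value**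
  `ζ⋆(k₁, …, k_r) = Σ_{n₁ ≥ n₂ ≥ ⋯ ≥ n_r ≥ 1} n₁^{-k₁} ⋯ n_r^{-k_r}` of an admissible index, through
  the finite expansion `ζ⋆(k) = ζ(k⋆)` (splitting each `≥` into `>` and `=`) [Hoffman1992, §1
  (the values `S(i₁,…,i_k)`); KanekoYamamoto2018, §2 (`ζ⋆(k) = ζ(k⋆)`)].

API proved here (list combinatorics only): the three defining equations, `k ∈ k⋆`, weight /
positivity / first-entry / admissibility / length bookkeeping of the members of `k⋆`, and the
expansion of a star with trailing ones by its first entry,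
`(a, 1ᵐ)⋆ = Σ_{j=0}^{m} (a + j)·(1^{m-j})⋆` (`starIndices_cons_replicate_one`; with `a = 1` this is
the recursion "first part `e = 1 + j`" of the compositions of `m + 1`).

## Deliberately NOT here

The series `Σ_{n₁ ≥ ⋯ ≥ n_r}` itself and its convergence (the definition goes through `ζ(k⋆)`),
Yamamoto's 2-poset integrals, the circled product `⊛`, and any relation among zeta-star values
(cyclic sum formula, Kaneko–Yamamoto's integral–series identity): none is needed as a definition.

## References

* M. E. Hoffman, *Multiple harmonic series*, Pacific J. Math. 152 (1992) 275–290, §1. [Hoffman1992]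
* M. Kaneko, S. Yamamoto, *A new integral–series identity of multiple zeta values and
  regularizations*, Selecta Math. 24 (2018) 2499–2521, §2, Thm 4.1. [KanekoYamamoto2018]
-/

namespace Literature.NumberTheory.Transcendental

namespace MZV

/-! ## The star expansion `k⋆` -/

/-- The **star expansion** `k⋆` of an index `k = (k₁, …, k_r)`: the `2^{r-1}` indices
`(k₁ ○ ⋯ ○ k_r)`, each `○` a comma or a `+`, as a list (recursion on the first `○`:
`(a, b, k)⋆ = a·(b, k)⋆ ++ (a+b, k)⋆`; `()⋆ = [()]`, `(a)⋆ = [(a)]`), so that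
`ζ⋆(k) = Σ_{u ∈ k⋆} ζ(u)` and `(1ⁿ)⋆` lists the compositions of `n`.
[cite: KanekoYamamoto2018, §2 (k⋆, the formal sum of 2^{r-1} indices)] -/
def starIndices : List ℕ → List (List ℕ)
  | [] => [[]]
  | [a] => [[a]]
  | a :: b :: k => (starIndices (b :: k)).map (List.cons a) ++ starIndices ((a + b) :: k)
termination_by k => k.length

/-- `()⋆ = [()]`. [cite: KanekoYamamoto2018, §2 (∅⋆ = ∅)] -/
@[simp] theorem starIndices_nil : starIndices [] = [[]] := by
  simp [starIndices]

/-- `(a)⋆ = [(a)]`. [cite: KanekoYamamoto2018, §2] -/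
@[simp] theorem starIndices_singleton (a : ℕ) : starIndices [a] = [[a]] := by
  simp [starIndices]

/-- The recursion on the first `○`: `(a, b, k)⋆ = a·(b, k)⋆ ++ (a + b, k)⋆`.
[cite: KanekoYamamoto2018, §2] -/
theorem starIndices_cons_cons (a b : ℕ) (k : List ℕ) :
    starIndices (a :: b :: k) =
      (starIndices (b :: k)).map (List.cons a) ++ starIndices ((a + b) :: k) := by
  simp [starIndices]

/-- `k⋆` is never the empty list. [cite: KanekoYamamoto2018, §2] -/
theorem starIndices_ne_nil : ∀ k : List ℕ, starIndices k ≠ []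
  | [] => by simp
  | [a] => by simp
  | a :: b :: k => by
    rw [starIndices_cons_cons]
    exact List.append_ne_nil_of_right_ne_nil _ (starIndices_ne_nil ((a + b) :: k))
termination_by k => k.length

/-- The index itself is a member of its star expansion (all `○` read as commas): `k ∈ k⋆`.
[cite: KanekoYamamoto2018, §2] -/
theorem self_mem_starIndices : ∀ k : List ℕ, k ∈ starIndices k
  | [] => by simp
  | [a] => by simp
  | a :: b :: k => by
    rw [starIndices_cons_cons, List.mem_append, List.mem_map]
    exact Or.inl ⟨b :: k, self_mem_starIndices (b :: k), rfl⟩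
termination_by k => k.length

/-- The star expansion preserves the weight: every `u ∈ k⋆` has `Σ u = Σ k`.
[cite: KanekoYamamoto2018, §2] -/
theorem sum_of_mem_starIndices : ∀ (k : List ℕ), ∀ u ∈ starIndices k, u.sum = k.sum
  | [], u, hu => by simp at hu; simp [hu]
  | [a], u, hu => by simp at hu; simp [hu]
  | a :: b :: k, u, hu => by
    rw [starIndices_cons_cons, List.mem_append, List.mem_map] at hu
    rcases hu with ⟨v, hv, rfl⟩ | hu
    · rw [List.sum_cons, List.sum_cons, sum_of_mem_starIndices (b :: k) v hv, List.sum_cons]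
    · rw [sum_of_mem_starIndices ((a + b) :: k) u hu]
      simp only [List.sum_cons]
      omega
termination_by k => k.length

/-- Members of `k⋆` are no longer than `k`. [cite: KanekoYamamoto2018, §2] -/
theorem length_le_of_mem_starIndices : ∀ (k : List ℕ), ∀ u ∈ starIndices k, u.length ≤ k.length
  | [], u, hu => by simp at hu; simp [hu]
  | [a], u, hu => by simp at hu; simp [hu]
  | a :: b :: k, u, hu => by
    rw [starIndices_cons_cons, List.mem_append, List.mem_map] at hu
    rcases hu with ⟨v, hv, rfl⟩ | hu
    · simpa using length_le_of_mem_starIndices (b :: k) v hv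
    · exact (length_le_of_mem_starIndices ((a + b) :: k) u hu).trans (by simp)
termination_by k => k.length

/-- Members of the star of a non-empty index are non-empty. [cite: KanekoYamamoto2018, §2] -/
theorem ne_nil_of_mem_starIndices : ∀ {k : List ℕ}, k ≠ [] → ∀ u ∈ starIndices k, u ≠ []
  | [], hk, _, _ => absurd rfl hk
  | [a], _, u, hu => by simp at hu; simp [hu]
  | a :: b :: k, _, u, hu => by
    rw [starIndices_cons_cons, List.mem_append, List.mem_map] at hu
    rcases hu with ⟨v, _, rfl⟩ | hu
    · exact List.cons_ne_nil a v
    · exact ne_nil_of_mem_starIndices (List.cons_ne_nil _ _) u hu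
termination_by k => k.length

/-- If all entries of `k` are positive, so are all entries of every member of `k⋆` (they are sums
of consecutive entries of `k`). [cite: KanekoYamamoto2018, §2] -/
theorem one_le_of_mem_starIndices : ∀ (k : List ℕ), (∀ i ∈ k, 1 ≤ i) →
    ∀ u ∈ starIndices k, ∀ i ∈ u, 1 ≤ i
  | [], _, u, hu, i, hi => by simp at hu; subst hu; simp at hi
  | [a], hk, u, hu, i, hi => by
    simp at hu; subst hu
    exact hk i hi
  | a :: b :: k, hk, u, hu, i, hi => by
    rw [starIndices_cons_cons, List.mem_append, List.mem_map] at hu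
    rcases hu with ⟨v, hv, rfl⟩ | hu
    · rcases List.mem_cons.mp hi with rfl | hi
      · exact hk _ (by simp)
      · exact one_le_of_mem_starIndices (b :: k) (fun j hj => hk j (List.mem_cons_of_mem _ hj)) v hv i hi
    · refine one_le_of_mem_starIndices ((a + b) :: k) (fun j hj => ?_) u hu i hi
      rcases List.mem_cons.mp hj with rfl | hj
      · have := hk a (by simp); omega
      · exact hk j (by simp [hj])
termination_by k => k.length

/-- The first entry of a member of `(a, k)⋆` is at least `a` (it is `a` plus a sum of following
entries). [cite: KanekoYamamoto2018, §2] -/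
theorem le_head_of_mem_starIndices : ∀ (a : ℕ) (k : List ℕ), ∀ u ∈ starIndices (a :: k),
    ∀ h : u ≠ [], a ≤ u.head h
  | _, [], u, hu, h => by simp at hu; subst hu; simp
  | a, b :: k, u, hu, h => by
    rw [starIndices_cons_cons, List.mem_append, List.mem_map] at hu
    rcases hu with ⟨v, _, rfl⟩ | hu
    · simp
    · exact (Nat.le_add_right a b).trans (le_head_of_mem_starIndices (a + b) k u hu h)
termination_by _ k => k.length

/-- The star expansion of an admissible index consists of admissible indices (first entry `≥ 2`,
all entries `≥ 1`, in the tree's convention `MZV.IsAdmissible`). [cite: KanekoYamamoto2018, §2] -/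
theorem isAdmissible_of_mem_starIndices {k : List ℕ} (hk : IsAdmissible k) {u : List ℕ}
    (hu : u ∈ starIndices k) : IsAdmissible u := by
  refine ⟨one_le_of_mem_starIndices k hk.1 u hu, fun hne => ?_⟩
  cases k with
  | nil => simp at hu; exact absurd hu hne
  | cons a k =>
    exact (hk.2 (List.cons_ne_nil a k)).trans (le_head_of_mem_starIndices a k u hu hne)

/-- **Expanding a star with trailing ones by its first entry**:
`(a, 1ᵐ)⋆ = Σ_{j=0}^{m} (a + j)·(1^{m-j})⋆` — the first entry of a member absorbs `j` of the
following ones (`0 ≤ j ≤ m`) and the rest is a member of `(1^{m-j})⋆`; with `a = 1` this is the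
recursion of the compositions of `m + 1` by their first part `1 + j`.
[cite: KanekoYamamoto2018, §2 (k⋆), Lemma 5.1 ((e₁ⁿ)⋆)] -/
theorem starIndices_cons_replicate_one (a m : ℕ) :
    starIndices (a :: List.replicate m 1) =
      (List.range (m + 1)).flatMap fun j =>
        (starIndices (List.replicate (m - j) 1)).map (List.cons (a + j)) := by
  induction m generalizing a with
  | zero => simp
  | succ m ih =>
    rw [List.replicate_succ, starIndices_cons_cons, ih (a + 1)]
    conv_rhs => rw [List.range_succ_eq_map, List.flatMap_cons, List.flatMap_map]
    congr 1
    refine List.flatMap_congr fun j _ => ?_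
    rw [show a + (j + 1) = a + 1 + j by omega, Nat.succ_eq_add_one, Nat.add_sub_add_right]

/-- `Σ` over a `flatMap` along `List.range` is the `Finset.range` sum of the sums. [folklore] -/
theorem sum_map_flatMap_range {M : Type*} [AddCommMonoid M] {β : Type*} (F : ℕ → List β) (f : β → M) :
    ∀ n : ℕ, (((List.range n).flatMap F).map f).sum = ∑ j ∈ Finset.range n, ((F j).map f).sum
  | 0 => by simp
  | n + 1 => by
    rw [List.range_succ, List.flatMap_append, List.map_append, List.sum_append,
      sum_map_flatMap_range F f n, Finset.sum_range_succ]
    simp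

/-- Summed form of `starIndices_cons_replicate_one` against a test function:
`Σ_{u ∈ (a,1ᵐ)⋆} f u = Σ_{j=0}^{m} Σ_{v ∈ (1^{m-j})⋆} f ((a+j) v)`.
[cite: KanekoYamamoto2018, §2 (k⋆)] -/
theorem sum_map_starIndices_cons_replicate_one {M : Type*} [AddCommMonoid M] (f : List ℕ → M)
    (a m : ℕ) :
    ((starIndices (a :: List.replicate m 1)).map f).sum =
      ∑ j ∈ Finset.range (m + 1),
        ((starIndices (List.replicate (m - j) 1)).map (f ∘ List.cons (a + j))).sum := by
  rw [starIndices_cons_replicate_one, sum_map_flatMap_range]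
  simp [List.map_map]

/-! ## Multiple zeta-star values -/

/-- The **multiple zeta-star value** `ζ⋆(k) = Σ_{n₁ ≥ ⋯ ≥ n_r ≥ 1} n₁^{-k₁} ⋯ n_r^{-k_r}` of an
admissible index, defined through the finite expansion `ζ⋆(k) = ζ(k⋆) = Σ_{u ∈ k⋆} ζ(u)` (each
`≥` split into `>` and `=`); `ζ⋆(∅) = 1`. For non-admissible `k` the value is the corresponding
combination of the junk values of `multipleZeta` and carries no meaning.
[cite: Hoffman1992, §1 (S(i₁,…,i_k)); KanekoYamamoto2018, §2 (ζ⋆(k) = ζ(k⋆))] -/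
noncomputable def multipleZetaStar (k : List ℕ) : ℝ :=
  ((starIndices k).map multipleZeta).sum

/-- `ζ⋆(∅) = 1`. [cite: KanekoYamamoto2018, §2 (ζ⋆(∅) = 1)] -/
theorem multipleZetaStar_nil : multipleZetaStar [] = 1 := by
  simp [multipleZetaStar, multipleZeta_nil]

/-- In depth one `ζ⋆(a) = ζ(a)`. [cite: Hoffman1992, §1] -/
theorem multipleZetaStar_singleton (a : ℕ) : multipleZetaStar [a] = multipleZeta [a] := by
  simp [multipleZetaStar]

/-- In depth two `ζ⋆(a, b) = ζ(a, b) + ζ(a + b)`. [cite: Hoffman1992, §1] -/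
theorem multipleZetaStar_pair (a b : ℕ) :
    multipleZetaStar [a, b] = multipleZeta [a, b] + multipleZeta [a + b] := by
  simp [multipleZetaStar, starIndices_cons_cons]

end MZV

end Literature.NumberTheory.Transcendental
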